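import Summits.ABC.ABC.Theorems.IsogenyGlueCongruenceTorsionSharingLine
import Summits.ABC.ABC.Theorems.IsogenyGlueCongruenceSemistableHeightPolyBound
import Literature.NumberTheory.EllipticCurves.SilvermanHeightLogDiscriminantProofs
import Literature.NumberTheory.EllipticCurves.ModularCurveNeronLatticeProofs
import Literature.NumberTheory.DiophantineGeometry.ConductorRadicalProofs
import Literature.NumberTheory.DiophantineGeometry.ConductorFactorizationProofs
import Literature.NumberTheory.DiophantineGeometry.MinimalDiscriminantFactorizationProofs
import Literature.NumberTheory.DiophantineGeometry.MinimalDiscriminantProofs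
import HarnessLib

/-!
# Crux K `TorsionSharingPrimeBound` (stmt-ABC-2157), line `SketchIdeator3g2` — stub `stub_levelLower`

The level-lowering piece `KLevelLowerBound` of K (partner newform `g` of level `M` with some prime
`p ∣ N = N_W`, `p ∤ M`; `ℓ ≥ 11`, `ℓ ∤ M N`) from the route item `SemistableHeightPolyBound`
(`h_F(W) ≤ c · N²` for semistable `W`) and the bundle of printed inputs `LevelMismatchFacts`, of
which only (a) (`ℓ ∣ ord_v(Δ_min)` at every place `v` of `ℤ` over a prime of `N` not dividing `M`;
Deligne + Mazur + Tate) and (d) (`N(𝔇) = |Δ_min|` for semistable `W`; Silverman 1986 §2) are used.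

Proof: with `v` the place below `p` (`Rat.HeightOneSpectrum.primesEquiv`), (a) gives
`ℓ ∣ e := ord_v(Δ_min)`; `p ∣ N` gives `f_v ≠ 0` (`factorization_conductorNorm_holds`), hence
`e ≠ 0` (`conductorExponent_ne_zero_iff_ordMinimalDiscriminant_ne_zero`) and `ℓ ≤ e`;
`p^e ∣ |Δ_min|` (`factorization_minimalDiscriminantNorm_holds`) gives `2^e ≤ |Δ_min|`, i.e.
`e · log 2 ≤ log |Δ_min|`; `log |Δ_min| ≤ 12 h(E/ℚ) + 16` (Pasten 2024 / Silverman 1986,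
`pasten2024_log_minimalDiscriminant_le_holds` on the Néron lattice of
`exists_isNeronLatticeOf_holds`, `faltingsHeight_eq_neronLatticeHeight`); (d) makes
`h(E/ℚ) = h_F(E)`, and `h_F(E) ≤ c N²`. Altogether `ℓ ≤ (12 max(c, 0) + 16) / log 2 · N²`.
-/

noncomputable section

-- `Summit.ABC.ABC` is the mandated summit-side namespace (single-conjunct summit).
set_option linter.dupNamespace false

open Literature.NumberTheory.EllipticCurves.ModularForms
open Summit.ABC.ABC.Theses.IsogenyGlueCongruence
open scoped MatrixGroups ModularForm
open CongruenceSubgroup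

namespace Summit.ABC.ABC.Theorems.IGCTorsionSharing

open WeierstrassCurve NumberField IsDedekindDomain

/-- For a globally minimal elliptic `W/ℚ`, `|Δ_W| = |Δ_min|` as real numbers
(`minimalDiscriminantNorm_int_eq_natAbs_minimalDiscriminantInt_holds`, `cast_minimalDiscriminantInt`). -/
private theorem abs_ratCast_Δ_eq_minimalDiscriminantNorm (W : WeierstrassCurve ℚ) [W.IsElliptic]
    [W.IsGloballyMinimal] :
    |((W.Δ : ℚ) : ℝ)| = (W.minimalDiscriminantNorm ℤ : ℝ) := by
  rw [minimalDiscriminantNorm_int_eq_natAbs_minimalDiscriminantInt_holds W,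
    ← cast_minimalDiscriminantInt W, Rat.cast_intCast, ← Int.cast_abs, Nat.cast_natAbs]

/-- For a semistable globally minimal elliptic `W/ℚ` the height over `ℚ` is the stable height:
the two closed formulas differ only by `log N(𝔇_min)` versus `log N(𝔇)`, and input (d) of
`LevelMismatchFacts` is `N(𝔇) = |Δ_min|`. -/
private theorem faltingsHeight_eq_stableFaltingsHeight_of_absNorm_eq (W : WeierstrassCurve ℚ)
    [W.IsElliptic] (hd : Ideal.absNorm W.jDenominatorIdeal = W.minimalDiscriminantNorm ℤ) :
    W.faltingsHeight = W.stableFaltingsHeight := by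
  unfold WeierstrassCurve.faltingsHeight WeierstrassCurve.stableFaltingsHeight
  rw [minimalDiscriminantNorm_ringOfIntegers_rat_holds W, hd]

/-- The height bound `h_F ≤ c N²` and the printed level-mismatch inputs give the level-lowering
piece of K: a congruence prime `ℓ ≥ 11`, `ℓ ∤ M N`, between `f_W` (`W` semistable of conductor `N`)
and a newform of level `M` missing a prime `p ∣ N` satisfies
`ℓ ≤ (12 max(c, 0) + 16) / log 2 · N²`. -/
theorem stub_levelLower : SemistableHeightPolyBound → LevelMismatchFacts → KLevelLowerBound := by
  intro hH hF
  obtain ⟨c, hc⟩ := hH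
  obtain ⟨hFa, -, -, hFd⟩ := hF
  refine ⟨2, (12 * max c 0 + 16) / Real.log 2, by norm_num, ?_⟩
  intro W _ _ _ hW M _ g hg _ ℓ hℓ hℓ11 hdiv hex hcong
  obtain ⟨p, hp, hpN, hpM⟩ := hex
  -- the place `v` of `ℤ` below `p`
  set v : HeightOneSpectrum ℤ := (Rat.HeightOneSpectrum.primesEquiv (R := ℤ)).symm ⟨p, hp⟩
    with hv
  have hgen : Rat.HeightOneSpectrum.natGenerator v = p :=
    congrArg Subtype.val ((Rat.HeightOneSpectrum.primesEquiv (R := ℤ)).apply_symm_apply ⟨p, hp⟩)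
  -- (a): `ℓ ∣ e = ord_v(Δ_min)`
  have hℓe : ℓ ∣ W.ordMinimalDiscriminant v :=
    hFa W hW M g hg ℓ hℓ hℓ11 hdiv hcong v (by rw [hgen]; exact hpN) (by rw [hgen]; exact hpM)
  -- `p ∣ N`, so `f_v ≠ 0` and `e ≠ 0`
  have hf : W.conductorExponent v ≠ 0 := by
    rw [← factorization_conductorNorm_holds W v, hgen]
    exact (hp.factorization_pos_of_dvd (NeZero.ne _) hpN).ne'
  have he0 : W.ordMinimalDiscriminant v ≠ 0 :=
    (conductorExponent_ne_zero_iff_ordMinimalDiscriminant_ne_zero v W).1 hf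
  have hℓle : ℓ ≤ W.ordMinimalDiscriminant v := Nat.le_of_dvd (Nat.pos_of_ne_zero he0) hℓe
  -- `2^e ≤ p^e ≤ |Δ_min|`
  have hΔpos : 0 < W.minimalDiscriminantNorm ℤ := minimalDiscriminantNorm_pos_holds W
  have hfac : (W.minimalDiscriminantNorm ℤ).factorization p = W.ordMinimalDiscriminant v := by
    rw [← hgen]
    exact factorization_minimalDiscriminantNorm_holds W v
  have h2e : 2 ^ W.ordMinimalDiscriminant v ≤ W.minimalDiscriminantNorm ℤ :=
    (Nat.pow_le_pow_left hp.two_le _).trans (hfac ▸ Nat.ordProj_le p hΔpos.ne')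
  -- `e · log 2 ≤ log |Δ_min|`
  have hlog2 : (0 : ℝ) < Real.log 2 := Real.log_pos one_lt_two
  have helog : (W.ordMinimalDiscriminant v : ℝ) * Real.log 2 ≤
      Real.log (W.minimalDiscriminantNorm ℤ : ℝ) := by
    rw [← Real.log_pow]
    exact Real.log_le_log (by positivity) (by exact_mod_cast h2e)
  -- `log |Δ_min| ≤ 12 h(E/ℚ) + 16 = 12 h_F(E) + 16 ≤ 12 c N² + 16`
  obtain ⟨L, hL⟩ := exists_isNeronLatticeOf_holds (W.baseChange ℂ)
  have hS := pasten2024_log_minimalDiscriminant_le_holds W L hL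
  rw [abs_ratCast_Δ_eq_minimalDiscriminantNorm W, ← faltingsHeight_eq_neronLatticeHeight W hL,
    faltingsHeight_eq_stableFaltingsHeight_of_absNorm_eq W (hFd W hW)] at hS
  have hcW : W.stableFaltingsHeight ≤ c * (W.conductorNorm ℤ : ℝ) ^ 2 := hc W hW
  -- assemble
  have hN1 : (1 : ℝ) ≤ (W.conductorNorm ℤ : ℝ) := by
    exact_mod_cast Nat.one_le_iff_ne_zero.2 (NeZero.ne _)
  have hN2 : (1 : ℝ) ≤ (W.conductorNorm ℤ : ℝ) ^ 2 := by nlinarith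
  have hcmax : c * (W.conductorNorm ℤ : ℝ) ^ 2 ≤ max c 0 * (W.conductorNorm ℤ : ℝ) ^ 2 :=
    mul_le_mul_of_nonneg_right (le_max_left _ _) (by positivity)
  have hmax0 : (0 : ℝ) ≤ max c 0 := le_max_right _ _
  have hℓeR : (ℓ : ℝ) ≤ (W.ordMinimalDiscriminant v : ℝ) := by exact_mod_cast hℓle
  rw [Real.rpow_two, div_mul_eq_mul_div, le_div_iff₀ hlog2]
  calc (ℓ : ℝ) * Real.log 2 ≤ (W.ordMinimalDiscriminant v : ℝ) * Real.log 2 :=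
        mul_le_mul_of_nonneg_right hℓeR hlog2.le
    _ ≤ Real.log (W.minimalDiscriminantNorm ℤ : ℝ) := helog
    _ ≤ 12 * W.stableFaltingsHeight + 16 := hS
    _ ≤ 12 * (max c 0 * (W.conductorNorm ℤ : ℝ) ^ 2) + 16 * (W.conductorNorm ℤ : ℝ) ^ 2 := by
        nlinarith [hcW, hcmax, hN2]
    _ = (12 * max c 0 + 16) * (W.conductorNorm ℤ : ℝ) ^ 2 := by ring

end Summit.ABC.ABC.Theorems.IGCTorsionSharing

end
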